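import Summits.BirchSwinnertonDyer.Rank1Residual.X10.CoreTheoremAOddPrimeOfStubs
import Summits.BirchSwinnertonDyer.BirchSwinnertonDyer.Theorems.SmallImageMuTransferMuTransferX9SelmerDualStub
import Summits.BirchSwinnertonDyer.BirchSwinnertonDyer.Theorems.SmallImageMuTransferMuTransferX9KolyvaginPackage
import Summits.BirchSwinnertonDyer.Rank1Residual.GaloisImage.PropagatedConditionCardEP
import Literature.NumberTheory.EllipticCurves.Kato2004.IwasawaCohomologyExistsProofs
import HarnessLib

/-!
# N2 (class X10b, `p = 3`) — the typed core `CoreTheoremAOddPrime`, the node `KatoMuTransferThree`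
# and the odd-prime `μ = 0` transfer ARE NOW THEOREMS MODULO THREE PUBLISHED FACTS: both open stubs of
# rung K6's crux `MuTransferX9` (skeleton v6/v6d, class-free) are proved in the tree (cell
# `b2b-bsdres`, unit `b2b-bsdres-x10` = N2 class lead, GEN 39; theorems only; nothing asserted,
# nothing booked)

HONEST FRAMING (run/shared/lean/b2b/bsd-rank1-residual/, verbatim in every file): the goal of the
cell is to DELETE the COMBINATION-SHAPED residual classes of the Birch–Swinnerton-Dyer formula for
analytic-rank `≤ 1` curves over `ℚ` using PUBLISHED theorems only, and to TYPE the
CONSTRUCTION-SHAPED remainder; this is not "finishing BSD".  Class X10b (= N2) is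
CONSTRUCTION-SHAPED / NEEDS X_A3 and stays so: this file REDUCES its typed core to NAMED PUBLISHED
FACTS (Kato 2004 §13.8; Poitou–Tate over `ℚ`; and, for the `μ`-transfer, Kato Thm. 12.6 + (14.9.3) +
§17.13), it books nothing, it moves no census word and no mark.  PARTITION (D-0054): X10b∧¬Surj
(A5) × p = 3 and X9 (A4) × p ∈ {5, 7} (the core is uniform in the odd prime) — types-the-object-of;
closes NONE (the K6 item closer is the `bsd-smallim` cell's `MuTransferX9Core`, stmt 19842).

## What

GEN 38 pre-wired `X10.coreTheoremAOddPrime_of_stubs (hred) (hPT) (hEP) (hG1) (hG34)` (p453933) to the two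
then-open stubs of skeleton v6.  Both stubs are now tree theorems —
`SelmerDual.stub_selmerDualOdd_holds` (k6-c2 p465845; lur-a, lur-b, k6-g4, k6-ty, x9, x10 inputs) and
`TameClass.stub_stepsTwoFourOdd_holds` (koly p474398; lur-b's assembly p472462, x10's meeting point with
value p469014, k6-g3's division, x9's seams and transport, lur-a's Euler factor) — and Tate's local
Euler–Poincaré characteristic is a tree theorem
(`GaloisImage.EP.forall_localEulerPoincareCharacteristic_adicCompletion`), as is Kato's (12.2.1) datum
(`Kato2004.nonempty_iwasawaH1Data_holds`).  Hence:

* **`coreTheoremAOddPrime_of_facts (hred) (hPT) : CoreTheoremAOddPrime`** — N2's typed core (GEN 37)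
  from Kato §13.8 (`Kato2004.mem_pSmul_of_red_eq_zero`) and Poitou–Tate over `ℚ`
  (`poitouTate_sum_localTatePairing_eq_zero ℚ`) ALONE;
* `coreTheoremAOnClassX10b_of_facts` — the registered `p = 3` shape (GEN 36);
* **`katoMuTransferThree_of_facts (hfine) (hred) (hPT) : KatoMuTransferThree`** — N2's `μ`-transfer
  node (cell `bsd-smallim` p407527) from Kato's Thm. 12.6 package with the fine quotient
  (`Kato2004.exists_divisibilityInputs_fineQuotient_zeta`), §13.8 and Poitou–Tate;
* `mu_eq_zero_of_facts` — the uniform odd-prime statement (`p ≠ 2`, good ordinary, `Irr`, `¬Surj`, one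
  unit coefficient of `L_p(f, α)` ⟹ `μ(X(E/ℚ_∞)) = 0` for every cyclotomic Selmer-dual datum);
* `mazurMainConjectureOnClassX10b_of_facts`, `bsdpOnClassX10b_of_facts` — GEN 36/37's A5 chain re-based:
  X_A3 on X10b and the class leaf `BSDpOnClassX10b` with the core hypothesis REPLACED by the three facts
  (the other published binders and the barrier-B3 input `AnalyticMuZeroOnClassX10b` unchanged).

References: K. Kato, Astérisque 295 (2004) Thm. 12.6 (p. 222), §13.8 (pp. 228–229), (14.9.3), §17.13
[Kato2004Asterisque]; J. S. Milne, *Arithmetic Duality Theorems* (2006) I Thm. 4.10 [MilneADT2006];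
R. Greenberg, V. Vatsal, Invent. Math. 142 (2000) Prop. 3.7 [GreenbergVatsal2000]; R. Greenberg, LNM 1716
(1999) Thm. 4.1 [GreenbergLNM1716].
-/

set_option linter.dupNamespace false
set_option autoImplicit false

noncomputable section

open scoped Classical MatrixGroups ModularForm NumberField
open CongruenceSubgroup WeierstrassCurve Field IsDedekindDomain
open Literature.NumberTheory.GaloisRepresentations
open Literature.NumberTheory.GaloisCohomology
open Literature.NumberTheory.EllipticCurves Literature.NumberTheory.EllipticCurves.ModularForms
open Literature.NumberTheory.EllipticCurves.Kato2004
open Literature.NumberTheory.EllipticCurves.Kato2004.EulerSystemValues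
open Literature.NumberTheory.EllipticCurves.Rank1Residual
open Summit.BirchSwinnertonDyer.BirchSwinnertonDyer.Theorems.Rank1ResidualX1Defs
  Summit.BirchSwinnertonDyer.BirchSwinnertonDyer.Rank1Residual

namespace Summit.BirchSwinnertonDyer.Rank1Residual.X10

/-- **N2's typed core from TWO published facts** (Kato §13.8, Poitou–Tate over `ℚ`): GEN 38's
`coreTheoremAOddPrime_of_stubs` with both stubs of skeleton v6 supplied by their tree proofs
(`SelmerDual.stub_selmerDualOdd_holds`, `TameClass.stub_stepsTwoFourOdd_holds`) and Tate's local
Euler–Poincaré characteristic by its tree proof.  Nothing asserted.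
[cite: Kato2004Asterisque, §13.8 (pp. 228–229)] [cite: MilneADT2006, Ch. I, Thm. 4.10(b)] -/
theorem coreTheoremAOddPrime_of_facts (hred : mem_pSmul_of_red_eq_zero)
    (hPT : poitouTate_sum_localTatePairing_eq_zero ℚ) : CoreTheoremAOddPrime :=
  coreTheoremAOddPrime_of_stubs hred hPT
    (GaloisImage.EP.forall_localEulerPoincareCharacteristic_adicCompletion ℚ)
    SelmerDual.stub_selmerDualOdd_holds TameClass.stub_stepsTwoFourOdd_holds

/-- **The registered `p = 3` shape `CoreTheoremAOnClassX10b` from the two facts** (GEN 36's node).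
[cite: Kato2004Asterisque, §13.8 (pp. 228–229)] [cite: MilneADT2006, Ch. I, Thm. 4.10(b)] -/
theorem coreTheoremAOnClassX10b_of_facts (hred : mem_pSmul_of_red_eq_zero)
    (hPT : poitouTate_sum_localTatePairing_eq_zero ℚ) : CoreTheoremAOnClassX10b :=
  coreTheoremAOnClassX10b_of_oddPrime (coreTheoremAOddPrime_of_facts hred hPT)

/-- **`μ(X(E/ℚ_∞)) = 0` at every odd good ordinary prime with `E[p]` irreducible and `ρ̄` not
surjective, given one unit coefficient of `L_p(f, α)` — from THREE published facts** (Kato Thm. 12.6 with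
(14.9.3)/§17.13: `exists_divisibilityInputs_fineQuotient_zeta`; Kato §13.8: `mem_pSmul_of_red_eq_zero`;
Poitou–Tate over `ℚ`); Kato (12.2.1) (`nonempty_iwasawaH1Data_holds`) and the core are tree theorems.
[cite: Kato2004Asterisque, Thm. 12.6 (p. 222), (14.9.3) (p. 240) and §17.13 (pp. 279–280)]
[cite: GreenbergVatsal2000, Prop. 3.7] [cite: MilneADT2006, Ch. I, Thm. 4.10(b)] -/
theorem mu_eq_zero_of_facts (hfine : exists_divisibilityInputs_fineQuotient_zeta)
    (hred : mem_pSmul_of_red_eq_zero) (hPT : poitouTate_sum_localTatePairing_eq_zero ℚ) :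
    ∀ (W : WeierstrassCurve ℚ) [W.IsElliptic] [W.IsGloballyMinimal] (p : ℕ) [Fact p.Prime]
      {N : ℕ} [NeZero N] (f : CuspForm (Gamma0 N) 2),
      p ≠ 2 → W.HasGoodReductionAtPrime p → ¬ (p : ℤ) ∣ W.frobeniusTrace p →
      W.HasIrreducibleModPGaloisRep p → ¬ W.HasSurjectiveModNGaloisRep p → IsNewformOf W f →
      (∃ n : ℕ, ‖PowerSeries.coeff n (padicLFunction f (unitRoot W p : ℚ_[p]))‖ = 1) →
      ∀ (κ : ZpExtension ℚ p) (γ : absoluteGaloisGroup ℚ),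
        κ.IsCyclotomic → κ.IsTopGenerator γ → IsCyclotomicVariable p γ →
        ∀ D : W.SelmerDualData κ γ, D.mu = 0 :=
  mu_eq_zero_of_coreOddPrime nonempty_iwasawaH1Data_holds hfine (coreTheoremAOddPrime_of_facts hred hPT)

/-- **N2: the `μ`-transfer node `KatoMuTransferThree` (cell `bsd-smallim`, p407527) from the three
published facts** (Kato's Thm. 12.6 package with the fine quotient, Kato §13.8, Poitou–Tate over `ℚ`).
[cite: Kato2004Asterisque, Thm. 12.6 (p. 222) and §17.13 (pp. 279–280)] [cite: GreenbergVatsal2000, Prop. 3.7] -/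
theorem katoMuTransferThree_of_facts (hfine : exists_divisibilityInputs_fineQuotient_zeta)
    (hred : mem_pSmul_of_red_eq_zero) (hPT : poitouTate_sum_localTatePairing_eq_zero ℚ) :
    KatoMuTransferThree :=
  katoMuTransferThree_of_coreOddPrime nonempty_iwasawaH1Data_holds hfine
    (coreTheoremAOddPrime_of_facts hred hPT)

/-- **X_A3 on class X10b with the core REPLACED by the three facts** (GEN 36/37's
`mazurMainConjectureOnClassX10b_of_coreOddPrime` re-based; Yan–Zhu 4.9 `hYZ` flagged
`YZ26@3-BF-ERL-Ohta` rides with the conclusion; `AnalyticMuZeroOnClassX10b` = barrier B3; nothing booked).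
[cite: YanZhu2024MainConjNonCM, Thm. 4.9 (§4.4)] [cite: Kato2004Asterisque, Thm. 12.6 (p. 222) and §17.13 (pp. 279–280)] -/
theorem mazurMainConjectureOnClassX10b_of_facts
    (hYZ : YanZhu2026.thm49_charIdeal_eq_padicLFunction)
    (h5 : realPeriodRat_eq_unit_mul_plusPeriod) (h3 : realPeriodRat_eq_unit_mul_plusPeriod_three)
    (hmodP : nonempty_modularParametrizationData)
    (hfine : exists_divisibilityInputs_fineQuotient_zeta) (hred : mem_pSmul_of_red_eq_zero)
    (hPT : poitouTate_sum_localTatePairing_eq_zero ℚ) (hA : AnalyticMuZeroOnClassX10b) :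
    MazurMainConjectureOnClassX10b :=
  mazurMainConjectureOnClassX10b_of_coreOddPrime hYZ h5 h3 hmodP nonempty_iwasawaH1Data_holds hfine
    (coreTheoremAOddPrime_of_facts hred hPT) hA

/-- **The A5 class leaf `BSDpOnClassX10b` with the core REPLACED by the three facts** (GEN 36/37's
`bsdpOnClassX10b_of_coreOddPrime` re-based): PUBLISHED binders (Yan–Zhu 4.9 flagged, Greenberg 4.1,
period units, PR–Schneider / PR 1987 / Mazur–Tate, modularity, GZK), Kato's Thm. 12.6 package, §13.8,
Poitou–Tate, the OPEN `AnalyticMuZeroOnClassX10b` (barrier B3) and the Schneider rider at rank `1`.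
Nothing booked. [cite: YanZhu2024MainConjNonCM, Thm. 4.9 (§4.4)]
[cite: GreenbergLNM1716, Thm. 4.1 (p. 102) and §1 Conj. 1.11]
[cite: Kato2004Asterisque, Thm. 12.6 (p. 222) and §17.13 (pp. 279–280)] [cite: Miller2011LMS, §1 and Def. 1.1] -/
theorem bsdpOnClassX10b_of_facts
    (hYZ : YanZhu2026.thm49_charIdeal_eq_padicLFunction)
    (hGr : greenberg_charValue_rankZero) (h5 : realPeriodRat_eq_unit_mul_plusPeriod)
    (h3 : realPeriodRat_eq_unit_mul_plusPeriod_three)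
    (hS : Schneider1985_order_charGenerator_odd) (hPR : perrinRiou_rankOne_leadingTerms_odd)
    (hMT : mazur_tate_sigma_exists_odd) (hmodP : nonempty_modularParametrizationData)
    (hGZK : rank_eq_analyticRank_of_analyticRank_le_one)
    (hfine : exists_divisibilityInputs_fineQuotient_zeta) (hred : mem_pSmul_of_red_eq_zero)
    (hPT : poitouTate_sum_localTatePairing_eq_zero ℚ) (hA : AnalyticMuZeroOnClassX10b)
    (hC3 : ∀ (W : WeierstrassCurve ℚ) [W.IsElliptic] [W.IsGloballyMinimal] (p : ℕ) [Fact p.Prime],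
      ClassX10 W p → ¬ Surj W 3 → W.analyticRank = 1 →
        ∀ Dh : PAdicHeightData W p, Dh.IsCanonical → SchneiderConjecture Dh) :
    BSDpOnClassX10b :=
  bsdpOnClassX10b_of_coreOddPrime hYZ hGr h5 h3 hS hPR hMT hmodP hGZK nonempty_iwasawaH1Data_holds hfine
    (coreTheoremAOddPrime_of_facts hred hPT) hA hC3

end Summit.BirchSwinnertonDyer.Rank1Residual.X10

end
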